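import Summits.KontsevichZagierPeriods.KontsevichZagierPeriods.Theses.HurwitzMicroSectors
import Summits.KontsevichZagierPeriods.KontsevichZagierPeriods.Theorems.HurwitzMicroSectorsNormalFormPrinciplePiBoxTransfer

/-! TTRL-lite variant V2219 of stmt-KontsevichZagierPeriods-3869

Variant V2219 = `stub_boxRigidity` with the left dimension BOUNDED, `bound_nat:m≤5` (the right
dimension `m'` free). Verdict of the attempt seat: **open, and provably as hard as the parent** — this
file is the certificate, not a proof of the variant. For EVERY bound `k` the one-sided restriction
`m ≤ k` (resp. `m' ≤ k`) of the leaf `BoxRigidity` is equivalent to the whole leaf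
(`boxRigidityLeftLe_iff`, `boxRigidityRightLe_iff`, tree, file `…Variants2256`): the bounded family
contains the frozen instance `m = 0` (resp. `m' = 0`), which is already the whole leaf
(`boxRigidityLeft_iff 0`, file `…Variants2200`: the zero representation on the `0`-box is box-rational
of value `0`, so one bounded side gives BoxVanishing in ALL dimensions, and BoxVanishing is
BoxRigidity by `boxRigidity_of_boxVanishing`). Hence
`KontsevichZagierPeriods → V2219 → KZ.PiLocalKernel` (`stub_boxRigidity_var2219_of_statement`,
`piLocalKernel_of_stub_boxRigidity_var2219`) and `KontsevichZagierPeriods ↔ V2219 ∧ PiCancellation`: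
the variant sits between the Summit and Ayoub's localised kernel conjecture (open), so it is neither
provable nor refutable from the tree, and the programmatic moves `bound_nat:m≤k` / `bound_nat:m'≤k`
of this stub never produce an easier statement (only a TWO-sided bound can: `m, m' ≤ 1` is the
theorem `boxRigidity_of_le_one`).
Source: M. Kontsevich, D. Zagier, *Periods* (2001), §1.2 Conjecture 1; J. Ayoub, EMS Newsl. 91 (2014),
Conj. 7. Pure proof file, no definitions. -/

-- `Summit.<Summit>.<Problem>` is the tree's mandated summit-side namespace (CONVENTIONS §2); for this
-- single-conjunct summit the two coincide, so the duplicate is deliberate.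
set_option linter.dupNamespace false

noncomputable section

namespace Summit.KontsevichZagierPeriods.KontsevichZagierPeriods.Theorems

open MeasureTheory Set
open Literature.NumberTheory.Transcendental Literature.NumberTheory.Transcendental.KZ
open Summit.KontsevichZagierPeriods.KontsevichZagierPeriods.Theses.HurwitzMicroSectors
open Summit.KontsevichZagierPeriods.HurwitzMicroSectors.NormalFormPrinciple.PiBox

/-! ## The variant V2219 itself: between the Summit and `KZ.PiLocalKernel` -/

/-- **V2219 ⟺ the parent leaf `BoxRigidity`** (the instance `k = 5` of `boxRigidityLeftLe_iff`, file
`…Variants2256`; proved here against `PiBoxTransfer` alone): from V2219, a box-rational representation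
`N` of value `0` in ANY dimension is a relation — compare it with the zero representation `Z` on the
`0`-box (`m = 0 ≤ 5`; box-rational, value `0`, itself a relation): `[Z] − [N] ∈ relations` — and
BoxVanishing is BoxRigidity (`boxRigidity_of_boxVanishing`). [cite: KontsevichZagier2001, §1.2 Conjecture 1] -/
theorem stub_boxRigidity_var2219_iff_parent :
    (∀ (m m' : ℕ) (N : IntegralRep m) (N' : IntegralRep m'), m ≤ 5 → N.domain = {x | ∀ i, x i ∈ Set.Ioo (0:ℝ) 1} → N.IsRational → N'.domain = {x | ∀ i, x i ∈ Set.Ioo (0:ℝ) 1} → N'.IsRational → N.value = N'.value → Equivalent N N') ↔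
    (∀ (m m' : ℕ) (N : IntegralRep m) (N' : IntegralRep m'), N.domain = {x | ∀ i, x i ∈ Set.Ioo (0:ℝ) 1} → N.IsRational → N'.domain = {x | ∀ i, x i ∈ Set.Ioo (0:ℝ) 1} → N'.IsRational → N.value = N'.value → Equivalent N N') := by
  refine ⟨fun hrig => boxRigidity_of_boxVanishing fun m N hNd hNr hv => ?_, fun h m m' N N' _ => h m m' N N'⟩
  obtain ⟨Z, hZd, hZi⟩ := exists_zeroRep (isSemialgebraic_box 0)
  have hZ : of Z ∈ relations := of_mem_relations_of_eqOn_zero Z (by simp [hZi, EqOn])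
  have hZv : Z.value = 0 := by simp [IntegralRep.value, hZi]
  have hZr : Z.IsRational := ⟨0, 1, fun x _ => by simp, fun x _ => by simp [hZi]⟩
  have h : of Z - of N ∈ relations :=
    hrig 0 m Z N (Nat.zero_le 5) hZd hZr hNd hNr (by rw [hv, hZv])
  have := relations.sub_mem hZ h
  rwa [sub_sub_cancel] at this

/-- **V2219 ⇒ `KZ.PiLocalKernel`** (Ayoub's localised kernel conjecture for this calculus — open): so a
proof of the variant would settle an open conjecture of the tree. [cite: Ayoub2014, Def. 6 and Conj. 7] -/
theorem piLocalKernel_of_stub_boxRigidity_var2219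
    (h : ∀ (m m' : ℕ) (N : IntegralRep m) (N' : IntegralRep m'), m ≤ 5 → N.domain = {x | ∀ i, x i ∈ Set.Ioo (0:ℝ) 1} → N.IsRational → N'.domain = {x | ∀ i, x i ∈ Set.Ioo (0:ℝ) 1} → N'.IsRational → N.value = N'.value → Equivalent N N') :
    PiLocalKernel :=
  piLocalKernel_of_boxRigidity (stub_boxRigidity_var2219_iff_parent.1 h)

/-- **`KontsevichZagierPeriods ⇒ V2219`**: the variant is a special case of Conjecture 1 for the
tree's calculus — so a refutation of the variant would refute the Summit. [cite: KontsevichZagier2001, §1.2 Conjecture 1] -/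
theorem stub_boxRigidity_var2219_of_statement (h : _root_.KontsevichZagierPeriods) :
    ∀ (m m' : ℕ) (N : IntegralRep m) (N' : IntegralRep m'), m ≤ 5 → N.domain = {x | ∀ i, x i ∈ Set.Ioo (0:ℝ) 1} → N.IsRational → N'.domain = {x | ∀ i, x i ∈ Set.Ioo (0:ℝ) 1} → N'.IsRational → N.value = N'.value → Equivalent N N' :=
  fun m m' N N' _ => (leaves_of_statement h).1 m m' N N'

/-- **Summit ⟺ V2219 ∧ PiCancellation** (from `statement_iff_leaves`): with `π`-cancellation the variant
is exactly what the Summit needs, no more and no less. [cite: KontsevichZagier2001, §1.2 Conjecture 1] -/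
theorem statement_iff_stub_boxRigidity_var2219_and_piCancellation :
    _root_.KontsevichZagierPeriods ↔
    ((∀ (m m' : ℕ) (N : IntegralRep m) (N' : IntegralRep m'), m ≤ 5 → N.domain = {x | ∀ i, x i ∈ Set.Ioo (0:ℝ) 1} → N.IsRational → N'.domain = {x | ∀ i, x i ∈ Set.Ioo (0:ℝ) 1} → N'.IsRational → N.value = N'.value → Equivalent N N') ∧
      PiCancellation) := by
  rw [statement_iff_leaves, stub_boxRigidity_var2219_iff_parent]

end Summit.KontsevichZagierPeriods.KontsevichZagierPeriods.Theorems
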